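import Summits.ResolutionOfSingularities.ResolutionOfSingularities.Theorems.PurelyInseparableDim4PiPlateauOmega
import Summits.ResolutionOfSingularities.ResolutionOfSingularities.Theorems.PurelyInseparableDim4TrapBaseChange
import Literature.Barriers.ResolutionOfSingularities.ResidualOrderUnboundedNarrow
import HarnessLib

/-!
# The letters `d`, `V_q`, `ω_q` are invariant under renaming of the variables and under base change (cell `res-dim4-pi`)

[OURS · counted 0 · bookkeeping]  Nothing here is a statement about resolution of singularities in dimension ≥ 4 /
characteristic `p`, which is NOT proved.  Desk WORD #9 (`…Target` §3, `SecondaryInvariantExistsSym`): a candidate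
letter should at least be invariant under renaming the base variables (`PIDim4.State.rename`); the census is
counted mod `S₄` and over field extensions (p-14 `ScopeSymmetry` p656454 did this for the scope / isolation letters).
This module records the same licence for the letters of the plateau law Π / the Ω move law
(`…PiPlateauStatement`, `…PiPlateauOmega`):

* §1 RENAMING (any injective `ι : σ → τ`, exceptional set `Δ ↦ Δ.image ι`): `isVActive_rename_iff`,
  `omegaLetter_rename` (with the tree's `HauserPerlega.residualOrder_rename`); for the frame's `State.rename` by a
  permutation of `Fin 4`: `residualOrder_stateRename`, `isVActive_stateRename_iff`, **`omegaLetter_stateRename`**.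
* §2 BASE CHANGE (`f : K →+* L` a homomorphism of fields, `F ↦ MvPolynomial.map f F`, same `Δ`): `exceptionalExp_map`,
  `divMonomial_map`, `residualOrder_map`, `isVActive_map_iff`, **`omegaLetter_map`** — all support-level.

Typed and proved by res-dim4-typ-1 (g2).  Supports stmt-ResolutionOfSingularities-16155 (helper).
bears_on: LADDER-RESOLUTION:D157-DOOR2 (res-dim4-pi · Π line · letter symmetry).
-/

set_option linter.dupNamespace false -- mandated namespace of this single-conjunct summit

namespace Summit.ResolutionOfSingularities.ResolutionOfSingularities.Theorems.PIDim4

namespace Plateau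

open MvPolynomial Finset
open Literature.AlgebraicGeometry.Resolution
open Literature.AlgebraicGeometry.Resolution.Hauser2010
open Literature.Barriers.ResolutionOfSingularities
open Literature.Barriers.ResolutionOfSingularities.HauserPerlega

/-! ## §1 Renaming the variables -/

section Rename

variable {σ τ : Type*} [DecidableEq σ] [DecidableEq τ] {K : Type*} [Field K] {ι : σ → τ}

omit [DecidableEq σ] in
/-- **`V_q` is invariant under an injective renaming** (`Δ ↦ Δ.image ι`). [folklore] -/
theorem isVActive_rename_iff (hι : Function.Injective ι) (q : ℕ) (Δ : Finset σ) (F : MvPolynomial σ K) :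
    IsVActive q (Δ.image ι) (rename ι F) ↔ IsVActive q Δ F := by
  unfold IsVActive
  rw [ordZero_rename hι, support_rename_of_injective hι]
  constructor
  · rintro ⟨a', ha', hdeg, i', hi', hqi'⟩
    obtain ⟨a, ha, rfl⟩ := Finset.mem_image.mp ha'
    rw [Finsupp.degree_mapDomain] at hdeg
    -- the witness variable is in the range of `ι`
    obtain ⟨i, rfl⟩ : i' ∈ Set.range ι := by
      by_contra h
      exact hqi' (by rw [Finsupp.mapDomain_notin_range a i' h]; exact dvd_zero q)
    rw [Finsupp.mapDomain_apply hι] at hqi'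
    exact ⟨a, ha, hdeg, i, fun h => hi' (Finset.mem_image_of_mem ι h), hqi'⟩
  · rintro ⟨a, ha, hdeg, i, hi, hqi⟩
    refine ⟨a.mapDomain ι, Finset.mem_image_of_mem _ ha, by rwa [Finsupp.degree_mapDomain], ι i, ?_, ?_⟩
    · intro h
      obtain ⟨i₀, hi₀, heq⟩ := Finset.mem_image.mp h
      exact hi (hι heq ▸ hi₀)
    · rwa [Finsupp.mapDomain_apply hι]

/-- **`ω_q` is invariant under an injective renaming.** [folklore] -/
theorem omegaLetter_rename (hι : Function.Injective ι) (q : ℕ) (Δ : Finset σ) (F : MvPolynomial σ K) :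
    omegaLetter q (Δ.image ι) (rename ι F) = omegaLetter q Δ F := by
  unfold omegaLetter
  rw [residualOrder_rename hι]
  by_cases h : IsVActive q Δ F
  · rw [if_pos h, if_pos ((isVActive_rename_iff hι q Δ F).mpr h)]
  · rw [if_neg h, if_neg (mt (isVActive_rename_iff hι q Δ F).mp h)]

end Rename

section StateRename

variable {K : Type} [Field K] (e : Equiv.Perm (Fin 4))

/-- The exceptional set of a renamed state is the image. [folklore] -/
theorem exc_stateRename (s : State K) : (State.rename e s).exc = s.exc.image e := by
  show s.exc.map e.toEmbedding = _
  rw [Finset.map_eq_image]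
  rfl

/-- **`d` is invariant under the frame's `State.rename`.** [folklore] -/
theorem residualOrder_stateRename (s : State K) :
    residualOrder (State.rename e s).exc (State.rename e s).F = residualOrder s.exc s.F := by
  rw [exc_stateRename]
  exact residualOrder_rename e.injective s.exc s.F

/-- **`V_q` is invariant under the frame's `State.rename`.** [folklore] -/
theorem isVActive_stateRename_iff (q : ℕ) (s : State K) :
    IsVActive q (State.rename e s).exc (State.rename e s).F ↔ IsVActive q s.exc s.F := by
  rw [exc_stateRename]
  exact isVActive_rename_iff e.injective q s.exc s.F

/-- **`ω_q` is invariant under the frame's `State.rename`** (desk WORD #9's requirement for a candidate letter).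
[folklore] -/
theorem omegaLetter_stateRename (q : ℕ) (s : State K) :
    omegaLetter q (State.rename e s).exc (State.rename e s).F = omegaLetter q s.exc s.F := by
  rw [exc_stateRename]
  exact omegaLetter_rename e.injective q s.exc s.F

end StateRename

/-! ## §2 Base change -/

section BaseChange

variable {σ : Type*} {K L : Type*} [Field K] [Field L] (f : K →+* L)

/-- `ord_{(xᵢ)}` is invariant under base change. [folklore] -/
theorem ordAlong_single_map (i : σ) (F : MvPolynomial σ K) :
    HauserPerlega.ordAlong i (MvPolynomial.map f F) = HauserPerlega.ordAlong i F := by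
  unfold HauserPerlega.ordAlong
  rw [MvPolynomial.support_map_of_injective F f.injective]

/-- **The exceptional exponent is invariant under base change.** [folklore] -/
theorem exceptionalExp_map (Δ : Finset σ) (F : MvPolynomial σ K) :
    exceptionalExp Δ (MvPolynomial.map f F) = exceptionalExp Δ F := by
  unfold exceptionalExp
  exact Finset.sum_congr rfl fun i _ => by rw [ordAlong_single_map]

/-- Division by a monomial commutes with base change. [folklore] -/
theorem divMonomial_map (F : MvPolynomial σ K) (r : σ →₀ ℕ) :
    MvPolynomial.divMonomial (MvPolynomial.map f F) r = MvPolynomial.map f (MvPolynomial.divMonomial F r) := by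
  ext m
  rw [coeff_divMonomial, coeff_map, coeff_map, coeff_divMonomial]

/-- **The residual order is invariant under base change.** [folklore] -/
theorem residualOrder_map (Δ : Finset σ) (F : MvPolynomial σ K) :
    residualOrder Δ (MvPolynomial.map f F) = residualOrder Δ F := by
  unfold residualOrder residualFactor
  rw [exceptionalExp_map, divMonomial_map, CampaignW46.MohWindowShadePS.ordZero_map]

/-- **`V_q` is invariant under base change.** [folklore] -/
theorem isVActive_map_iff (q : ℕ) (Δ : Finset σ) (F : MvPolynomial σ K) :
    IsVActive q Δ (MvPolynomial.map f F) ↔ IsVActive q Δ F := by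
  unfold IsVActive
  rw [CampaignW46.MohWindowShadePS.ordZero_map, MvPolynomial.support_map_of_injective F f.injective]

/-- **`ω_q` is invariant under base change** (so the census of `ω_q` may be read over any extension field, and
rational chains lift with their letters). [folklore] -/
theorem omegaLetter_map (q : ℕ) (Δ : Finset σ) (F : MvPolynomial σ K) :
    omegaLetter q Δ (MvPolynomial.map f F) = omegaLetter q Δ F := by
  unfold omegaLetter
  rw [residualOrder_map]
  by_cases h : IsVActive q Δ F
  · rw [if_pos h, if_pos ((isVActive_map_iff f q Δ F).mpr h)]
  · rw [if_neg h, if_neg (mt (isVActive_map_iff f q Δ F).mp h)]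

end BaseChange

end Plateau

end Summit.ResolutionOfSingularities.ResolutionOfSingularities.Theorems.PIDim4
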